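import Summits.QuantumFields.BalabanUV.T4Continuum.Support.NE3SlicePoincareBudgetLine
import HarnessLib

/-!
# NE3SlicePoincareBudgetLineY (T⁴ programme, node NE3, row NE3-R2 × row K6 of route H♮) — THE k-FREE LINE BEHIND THE TWO DISPLAYED
# SMALLNESS CONDITIONS OF (P♮)_W, PART 2: `S_y`, `s₂` and the second smallness quantity `2·K_h·S_y + s₂` against `SmallYLine`

Row NE3-R2 (`b2b-balaban-t4-ne3r2-p1`, gen 11; K-g11-1 part 2, census D-ne3r2-g11-1).  In the LETTERS of leaf-02's p237300
`NE3SlicePoincareBudget.budget` (the named verbatim expressions of part 1): `S_y ≤ SyLine`, `s₂ ≤ sTwoLine`, and the `hSy`-quantity `2·K_h·S_y + s₂ ≤ SmallYLine`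
(`2 ≤ L ≤ M`, `0 ≤ x`, `M²x ≤ θ`, the K-road tops of `lr`, `DS`, `S2`, `aU`, `Λ = L^{d−2}·M²`, `1 ≤ c`, `0 < ε`).  The `M`'s cancel exactly
(`Λ∕M²`, `(M²)⁻¹·M²`, `(1∕M + 2c_x)²·M²`, `d_K1·M²`) or sit as `1∕M ≤ 1∕L`.  All [folklore]; elementary real inequalities; 0 sorry; 0 def.
HONEST FRAMING.  Arithmetic on OUR displayed constants; nothing about Bałaban's minimisers; (P♮)_W is leaf-02's theorem; (ML_w) at `W ≠ 1`,
T-E_w♯ and NE3 are NOT proved; spine PROVED 0∕9; finite T⁴ rung (B)+1 — NOT infinite volume, NOT mass gap, NOT BetaPertH, NOT Clay.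
PLACEMENT: `Summits/QuantumFields/BalabanUV/`.  HONEST DEPENDENCY: continuum YM on T⁴ ⇐ BetaPertH ∧ nine spine estimates (0/9 proved);
BetaPertH ⇐ (D1) ∧ (D4) ∧ CAP+tail; G-an2-4 gates asym, D1 and NE2/3/4.
-/

set_option autoImplicit false

namespace Summit.QuantumFields.BalabanUV.T4Continuum.NE3SlicePoincareBudgetLineY

open NE3CovariantLineSumsL2 (C2sq)
open NE3SlicePoincareBudgetLine

noncomputable section

/-! ## §1 `S_y` against the line -/

set_option maxHeartbeats 800000 in
/-- **`S_y ≤ SyLine`** (letters of p237300). [folklore] -/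
theorem Sy_le_line {d L c : ℕ} (hd : 2 ≤ d) {M x θ lr S2 Λ ε : ℝ} (hL : 2 ≤ (L : ℝ)) (hLM : (L : ℝ) ≤ M) (hx : 0 ≤ x)
    (hθ : M ^ 2 * x ≤ θ) (hlr0 : 0 ≤ lr) (hlr : lr ≤ lrTop d θ) (hS20 : 0 ≤ S2) (hS2 : S2 ≤ sTop d L θ)
    (hΛ : Λ = (L : ℝ) ^ (d - 2) * M ^ 2) (hc : 1 ≤ (c : ℝ)) (hε : 0 < ε) :
    syExpr d c M x lr S2 Λ ε ≤ SyLine d L c ε θ := by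
  unfold syExpr
  have hd' : 1 ≤ d := by omega
  have hM : 1 ≤ M := by linarith
  have hM0 : 0 < M := by linarith
  have hMne : M ≠ 0 := hM0.ne'
  obtain ⟨hθ0, hM1x, hMMx, -⟩ := atoms hM hx hθ
  have hd1 : (1 : ℝ) ≤ d := by exact_mod_cast hd'
  have hd0 : (0 : ℝ) ≤ d := by linarith
  have hdm : (0 : ℝ) ≤ (d : ℝ) - 1 := by linarith
  have hc0 : (0 : ℝ) ≤ c := by linarith
  have hL0 : (0 : ℝ) < L := by linarith
  have hA := A_le_line hd' hM hx hθ hlr0 hlr hc hε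
  set cx := ((d : ℝ) - 1) * (M - 1) * x with hcx
  set CJ := 4 * (d : ℝ) ^ 2 * (M - 1) ^ 2 * x + 16 * d * lr with hCJ
  set cf := 2 * (8 * lr) + 2 * (2 * (((d : ℝ) - 1) * (M - 1) * M * x)) with hcf
  -- atoms
  have hcx0 : 0 ≤ cx := mul_nonneg (mul_nonneg hdm (by linarith)) hx
  have hMcx : M * cx ≤ ((d : ℝ) - 1) * θ := by
    have e : M * cx = ((d : ℝ) - 1) * ((M - 1) * M * x) := by rw [hcx]; ring
    rw [e]; exact mul_le_mul_of_nonneg_left hMMx hdm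
  have hMcx0 : 0 ≤ M * cx := mul_nonneg hM0.le hcx0
  have hCJle : CJ ≤ cjTop d θ := by
    have h1 : 4 * (d : ℝ) ^ 2 * (M - 1) ^ 2 * x ≤ 4 * (d : ℝ) ^ 2 * θ := by
      have := mul_le_mul_of_nonneg_left hM1x (show (0 : ℝ) ≤ 4 * (d : ℝ) ^ 2 by positivity); linarith
    have h2 : 16 * (d : ℝ) * lr ≤ 16 * d * lrTop d θ := mul_le_mul_of_nonneg_left hlr (by positivity)
    rw [hCJ]; unfold cjTop; linarith
  have hCJ0 : 0 ≤ CJ := by rw [hCJ]; positivity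
  have hcxM0 : 0 ≤ ((d : ℝ) - 1) * (M - 1) * M * x := mul_nonneg (mul_nonneg (mul_nonneg hdm (by linarith)) hM0.le) hx
  have hcfle : cf ≤ cfTop d θ := by
    have h1 := mul_le_mul_of_nonneg_left hMMx hdm
    have e : ((d : ℝ) - 1) * (M - 1) * M * x = ((d : ℝ) - 1) * ((M - 1) * M * x) := by ring
    rw [hcf, e]; unfold cfTop; linarith only [h1, hlr]
  have hcf0 : 0 ≤ cf := by rw [hcf]; positivity
  have hsc : Real.sqrt (c : ℝ) ≤ c := (Real.sqrt_le_left (by positivity)).2 (by nlinarith)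
  have hsc0 : 0 ≤ Real.sqrt (c : ℝ) := Real.sqrt_nonneg _
  have hcd1 : (1 : ℝ) ≤ (c : ℝ) * d := by nlinarith
  have hscd : Real.sqrt ((c : ℝ) * d) ≤ c * d := (Real.sqrt_le_left (by positivity)).2 (by nlinarith [hcd1])
  have hscd0 : 0 ≤ Real.sqrt ((c : ℝ) * d) := Real.sqrt_nonneg _
  have hlT0 : 0 ≤ lrTop d θ := hlr0.trans hlr
  have hsT0 : 0 ≤ sTop d L θ := hS20.trans hS2
  have hcfT0 : 0 ≤ cfTop d θ := hcf0.trans hcfle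
  have hA0 : 0 ≤ 18 + 1 / 4 + 16 * cf * Real.sqrt (c : ℝ) / ε ^ 2 := by positivity
  have hAL0 : 0 ≤ ALine d c ε θ := hA0.trans hA
  -- term 1: `Λ∕M² = L^{d−2}`
  have u1 : 512 * (16 * S2 ^ 2 * Λ) * (c : ℝ) / M ^ 2 ≤ 512 * (16 * sTop d L θ ^ 2 * (L : ℝ) ^ (d - 2)) * c := by
    have e : 512 * (16 * S2 ^ 2 * Λ) * (c : ℝ) / M ^ 2 = 512 * (16 * S2 ^ 2 * (L : ℝ) ^ (d - 2)) * c := by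
      rw [hΛ]; field_simp
    rw [e]; gcongr
  -- term 2
  have u2 : 512 * (2 * ((d : ℝ) * (20 * lr) ^ 2)) * (c : ℝ) / ε ^ 2 ≤ 512 * (2 * ((d : ℝ) * (20 * lrTop d θ) ^ 2)) * c / ε ^ 2 := by
    gcongr
  -- term 3: `K ≤ kTop`
  have u3 : 8 * (8 * d * (M * cx) ^ 2 + 2 * ((c : ℝ) * CJ ^ 2)) / ε ≤ 8 * kTop d c θ / ε := by
    unfold kTop; gcongr
  -- term 4
  have u4 : 16 * cx * Real.sqrt ((c : ℝ) * d) * M / ε ^ 2 ≤ 16 * (((d : ℝ) - 1) * θ) * (c * d) / ε ^ 2 := by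
    have e : 16 * cx * Real.sqrt ((c : ℝ) * d) * M / ε ^ 2 = 16 * (M * cx) * Real.sqrt ((c : ℝ) * d) / ε ^ 2 := by ring
    rw [e]; gcongr
  -- term 5
  have u5 : 8 * cf * Real.sqrt (c : ℝ) * d ≤ 8 * cfTop d θ * c * d := by gcongr
  -- term 6: `x²·M⁴ = (M²x)²`
  have u6 : (18 + 1 / 4 + 16 * cf * Real.sqrt (c : ℝ) / ε ^ 2) * ((16 * (d : ℝ) ^ 2 * x ^ 2) * M ^ 4 / ε ^ 2 + ε ^ 2)
      ≤ ALine d c ε θ * (16 * (d : ℝ) ^ 2 * θ ^ 2 / ε ^ 2 + ε ^ 2) := by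
    have e : (16 * (d : ℝ) ^ 2 * x ^ 2) * M ^ 4 / ε ^ 2 = 16 * (d : ℝ) ^ 2 * (M ^ 2 * x) ^ 2 / ε ^ 2 := by ring
    rw [e]
    have hMx0 : 0 ≤ M ^ 2 * x := by positivity
    have hin : 16 * (d : ℝ) ^ 2 * (M ^ 2 * x) ^ 2 / ε ^ 2 + ε ^ 2 ≤ 16 * (d : ℝ) ^ 2 * θ ^ 2 / ε ^ 2 + ε ^ 2 := by gcongr
    have hin0 : 0 ≤ 16 * (d : ℝ) ^ 2 * (M ^ 2 * x) ^ 2 / ε ^ 2 + ε ^ 2 := by positivity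
    calc (18 + 1 / 4 + 16 * cf * Real.sqrt (c : ℝ) / ε ^ 2) * (16 * (d : ℝ) ^ 2 * (M ^ 2 * x) ^ 2 / ε ^ 2 + ε ^ 2)
        ≤ ALine d c ε θ * (16 * (d : ℝ) ^ 2 * (M ^ 2 * x) ^ 2 / ε ^ 2 + ε ^ 2) := mul_le_mul_of_nonneg_right hA hin0
      _ ≤ ALine d c ε θ * (16 * (d : ℝ) ^ 2 * θ ^ 2 / ε ^ 2 + ε ^ 2) := mul_le_mul_of_nonneg_left hin hAL0
  unfold SyLine
  linarith only [u1, u2, u3, u4, u5, u6]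

/-! ## §2 `s₂` against the line -/

set_option maxHeartbeats 800000 in
/-- **`s₂ ≤ sTwoLine`** (letters of p237300). [folklore] -/
theorem sTwo_le_line {d L c : ℕ} (hd : 2 ≤ d) {M x θ lr S2 Λ aU ε : ℝ} (hL : 2 ≤ (L : ℝ)) (hLM : (L : ℝ) ≤ M) (hx : 0 ≤ x)
    (hθ : M ^ 2 * x ≤ θ) (hlr0 : 0 ≤ lr) (hlr : lr ≤ lrTop d θ) (hS20 : 0 ≤ S2) (hS2 : S2 ≤ sTop d L θ)
    (hΛ : Λ = (L : ℝ) ^ (d - 2) * M ^ 2) (haU0 : 0 ≤ aU) (haU : aU ≤ (17 / 16) ^ 2 * θ) (hc : 1 ≤ (c : ℝ)) (hε : 0 < ε) :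
    sTwoExpr d c M x lr S2 Λ aU ε ≤ sTwoLine d L c ε θ := by
  unfold sTwoExpr g8Expr byExpr gzExpr
  have hd' : 1 ≤ d := by omega
  have hM : 1 ≤ M := by linarith
  have hM0 : 0 < M := by linarith
  have hMne : M ≠ 0 := hM0.ne'
  obtain ⟨hθ0, hM1x, hMMx, -⟩ := atoms hM hx hθ
  have hd1 : (1 : ℝ) ≤ d := by exact_mod_cast hd'
  have hd0 : (0 : ℝ) ≤ d := by linarith
  have hdm : (0 : ℝ) ≤ (d : ℝ) - 1 := by linarith
  have hc0 : (0 : ℝ) ≤ c := by linarith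
  have hL0 : (0 : ℝ) < L := by linarith
  set cx := ((d : ℝ) - 1) * (M - 1) * x with hcx
  set w := 1 / M + 2 * cx with hw
  set CJ := 4 * (d : ℝ) ^ 2 * (M - 1) ^ 2 * x + 16 * d * lr with hCJ
  set G := 16 * (d : ℝ) * w ^ 2 * (64 : ℝ) ^ d * CJ ^ 2 * (c : ℝ) with hG
  set T1 := 3 * ((2 : ℝ) ^ (d + 1)) * (M ^ 2)⁻¹ + 3 * ((d : ℝ) * w ^ 2) * (2 * ((64 : ℝ) ^ d) * (((2 : ℝ) ^ (3 * d + 2)) * d)) with hT1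
  set DK := (d : ℝ) * (2 : ℝ) ^ d * (8 * ((d : ℝ) * M * x) ^ 2 + (16 / M ^ 2) * (8 * lr + 9 * (d : ℝ) ^ 2 * M ^ 2 * x) ^ 2) with hDK
  set PK := (2 : ℝ) ^ d * ((2 : ℝ) ^ (2 * d + 4) * (d : ℝ) ^ 2 * ((d : ℝ) - 1) ^ 2 * (aU) ^ 2
    + 8 * (9 * (d : ℝ) ^ 2 * M ^ 2 * x + (d : ℝ) * (8 * lr)) ^ 2) with hPK
  -- atoms
  have hcx0 : 0 ≤ cx := mul_nonneg (mul_nonneg hdm (by linarith)) hx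
  have hMcx : M * cx ≤ ((d : ℝ) - 1) * θ := by
    have e : M * cx = ((d : ℝ) - 1) * ((M - 1) * M * x) := by rw [hcx]; ring
    rw [e]; exact mul_le_mul_of_nonneg_left hMMx hdm
  have hMcx0 : 0 ≤ M * cx := mul_nonneg hM0.le hcx0
  have hwM : w * M = 1 + 2 * (M * cx) := by rw [hw]; field_simp
  have hwM0 : 0 ≤ w * M := by rw [hwM]; positivity
  have hwMle : w * M ≤ wTop d θ := by rw [hwM]; unfold wTop; linarith
  have hwT0 : 0 ≤ wTop d θ := hwM0.trans hwMle
  have hw0 : 0 ≤ w := by rw [hw]; positivity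
  have hCJle : CJ ≤ cjTop d θ := by
    have h1 : 4 * (d : ℝ) ^ 2 * (M - 1) ^ 2 * x ≤ 4 * (d : ℝ) ^ 2 * θ := by
      have := mul_le_mul_of_nonneg_left hM1x (show (0 : ℝ) ≤ 4 * (d : ℝ) ^ 2 by positivity); linarith
    have h2 : 16 * (d : ℝ) * lr ≤ 16 * d * lrTop d θ := mul_le_mul_of_nonneg_left hlr (by positivity)
    rw [hCJ]; unfold cjTop; linarith
  have hCJ0 : 0 ≤ CJ := by rw [hCJ]; positivity
  have hcT0 : 0 ≤ cjTop d θ := hCJ0.trans hCJle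
  have hlT0 : 0 ≤ lrTop d θ := hlr0.trans hlr
  have hsT0 : 0 ≤ sTop d L θ := hS20.trans hS2
  have hG0 : 0 ≤ G := by rw [hG]; positivity
  have hT10 : 0 ≤ T1 := by rw [hT1]; positivity
  have hDK0 : 0 ≤ DK := by rw [hDK]; positivity
  have hPK0 : 0 ≤ PK := by rw [hPK]; positivity
  have hMx0 : 0 ≤ M ^ 2 * x := by positivity
  -- `g_q·8·M²`
  have hG8 : G * 8 * M ^ 2 ≤ gTop d c θ := by
    have e : G * 8 * M ^ 2 = (16 * (d : ℝ) * (w * M) ^ 2 * (64 : ℝ) ^ d * CJ ^ 2 * (c : ℝ)) * 8 := by rw [hG]; ring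
    rw [e]; unfold gTop; gcongr
  have hG80 : 0 ≤ G * 8 * M ^ 2 := by positivity
  have hgT0 : 0 ≤ gTop d c θ := hG80.trans hG8
  -- `g_q·g_z·M²∕ε²`
  have hGZ : G * (4 * (c : ℝ) * CJ ^ 2 + 1) * (M ^ 2 / ε ^ 2) ≤ gzTop d c ε θ := by
    have e : G * (4 * (c : ℝ) * CJ ^ 2 + 1) * (M ^ 2 / ε ^ 2)
        = 16 * (d : ℝ) * (w * M) ^ 2 * (64 : ℝ) ^ d * CJ ^ 2 * (c : ℝ) * (4 * (c : ℝ) * CJ ^ 2 + 1) / ε ^ 2 := by rw [hG]; ring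
    rw [e]; unfold gzTop; gcongr
  -- `b_y`, first product: `(M²)⁻¹·M²` and `(1∕M + 2c_x)²·M²` cancel, `Λ∕M² = L^{d−2}`
  have hBY1 : T1 * ((c : ℝ) * (2 * (16 * S2 ^ 2 * Λ) * (c : ℝ)) + (c : ℝ) * (2 * (2 * ((d : ℝ) * (20 * lr) ^ 2)) * (c : ℝ)) * (M ^ 2 / ε ^ 2))
      ≤ (3 * (2 : ℝ) ^ (d + 1) + 3 * ((d : ℝ) * wTop d θ ^ 2) * (2 * (64 : ℝ) ^ d * ((2 : ℝ) ^ (3 * d + 2) * d)))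
        * (c * (2 * (16 * sTop d L θ ^ 2 * (L : ℝ) ^ (d - 2)) * c) + c * (2 * (2 * ((d : ℝ) * (20 * lrTop d θ) ^ 2)) * c) / ε ^ 2) := by
    have e : T1 * ((c : ℝ) * (2 * (16 * S2 ^ 2 * Λ) * (c : ℝ)) + (c : ℝ) * (2 * (2 * ((d : ℝ) * (20 * lr) ^ 2)) * (c : ℝ)) * (M ^ 2 / ε ^ 2))
        = (3 * (2 : ℝ) ^ (d + 1) + 3 * ((d : ℝ) * (w * M) ^ 2) * (2 * (64 : ℝ) ^ d * ((2 : ℝ) ^ (3 * d + 2) * d)))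
          * (c * (2 * (16 * S2 ^ 2 * (L : ℝ) ^ (d - 2)) * c) + c * (2 * (2 * ((d : ℝ) * (20 * lr) ^ 2)) * c) / ε ^ 2) := by
      rw [hT1, hΛ]; field_simp
    rw [e]; gcongr
  -- `b_y`, second product: `d_K1·M²`
  have hDKM : DK * M ^ 2 ≤ dkTop d θ := by
    have e : DK * M ^ 2 = (d : ℝ) * (2 : ℝ) ^ d * (8 * ((d : ℝ) ^ 2 * (M ^ 2 * x) ^ 2) + 16 * (8 * lr + 9 * (d : ℝ) ^ 2 * (M ^ 2 * x)) ^ 2) := by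
      rw [hDK]; field_simp
    rw [e]; unfold dkTop; gcongr
  have hPKle : PK ≤ pkTop d θ := by
    have e : PK = (2 : ℝ) ^ d * ((2 : ℝ) ^ (2 * d + 4) * (d : ℝ) ^ 2 * ((d : ℝ) - 1) ^ 2 * aU ^ 2
        + 8 * (9 * (d : ℝ) ^ 2 * (M ^ 2 * x) + (d : ℝ) * (8 * lr)) ^ 2) := by rw [hPK]; ring
    rw [e]; unfold pkTop; gcongr
  have hBY2 : (3 * DK + 3 * ((d : ℝ) * w ^ 2) * (2 * ((64 : ℝ) ^ d) * PK)) * (c : ℝ) * (M ^ 2 / ε ^ 2)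
      ≤ (3 * dkTop d θ + 3 * ((d : ℝ) * wTop d θ ^ 2) * (2 * (64 : ℝ) ^ d * pkTop d θ)) * c / ε ^ 2 := by
    have e : (3 * DK + 3 * ((d : ℝ) * w ^ 2) * (2 * ((64 : ℝ) ^ d) * PK)) * (c : ℝ) * (M ^ 2 / ε ^ 2)
        = (3 * (DK * M ^ 2) + 3 * ((d : ℝ) * (w * M) ^ 2) * (2 * (64 : ℝ) ^ d * PK)) * c / ε ^ 2 := by ring
    rw [e]
    have hDKM0 : 0 ≤ DK * M ^ 2 := by positivity
    gcongr
  have hBY0 : 0 ≤ T1 * ((c : ℝ) * (2 * (16 * S2 ^ 2 * Λ) * (c : ℝ)) + (c : ℝ) * (2 * (2 * ((d : ℝ) * (20 * lr) ^ 2)) * (c : ℝ)) * (M ^ 2 / ε ^ 2))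
      + (3 * DK + 3 * ((d : ℝ) * w ^ 2) * (2 * ((64 : ℝ) ^ d) * PK)) * (c : ℝ) * (M ^ 2 / ε ^ 2) := by
    have hΛ0 : 0 ≤ Λ := by rw [hΛ]; positivity
    positivity
  have hBY : T1 * ((c : ℝ) * (2 * (16 * S2 ^ 2 * Λ) * (c : ℝ)) + (c : ℝ) * (2 * (2 * ((d : ℝ) * (20 * lr) ^ 2)) * (c : ℝ)) * (M ^ 2 / ε ^ 2))
      + (3 * DK + 3 * ((d : ℝ) * w ^ 2) * (2 * ((64 : ℝ) ^ d) * PK)) * (c : ℝ) * (M ^ 2 / ε ^ 2) ≤ byTop d L c ε θ := by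
    unfold byTop; exact add_le_add hBY1 hBY2
  have hbT0 : 0 ≤ byTop d L c ε θ := hBY0.trans hBY
  have hGZ0 : 0 ≤ G * (4 * (c : ℝ) * CJ ^ 2 + 1) * (M ^ 2 / ε ^ 2) := by positivity
  unfold sTwoLine
  gcongr

/-! ## §3 The second displayed smallness quantity against the line -/

set_option maxHeartbeats 800000 in
/-- **`2·K_h·S_y + s₂ ≤ SmallYLine`** — the left-hand side of p237300's `hSy` (`smallYExpr`, which unfolds to it token for token). [folklore] -/
theorem smallY_le_line {d L c : ℕ} (hd : 2 ≤ d) {M x θ lr DS S2 Λ aU ε : ℝ} (hL : 2 ≤ (L : ℝ)) (hLM : (L : ℝ) ≤ M)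
    (hx : 0 ≤ x) (hθ : M ^ 2 * x ≤ θ) (hlr0 : 0 ≤ lr) (hlr : lr ≤ lrTop d θ) (hDS0 : 0 ≤ DS) (hDS : DS ≤ 20 * lr)
    (hS20 : 0 ≤ S2) (hS2 : S2 ≤ sTop d L θ) (hΛ : Λ = (L : ℝ) ^ (d - 2) * M ^ 2) (haU0 : 0 ≤ aU)
    (haU : aU ≤ (17 / 16) ^ 2 * θ) (hc : 1 ≤ (c : ℝ)) (hε : 0 < ε) :
    smallYExpr d L c M x lr DS S2 Λ aU ε ≤ SmallYLine d L c ε θ := by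
  unfold smallYExpr
  have hd' : 1 ≤ d := by omega
  have hM0 : 0 < M := by linarith
  have hd1 : (1 : ℝ) ≤ d := by exact_mod_cast hd'
  have hdm : (0 : ℝ) ≤ (d : ℝ) - 1 := by linarith
  have hc0 : (0 : ℝ) ≤ c := by linarith
  have hK := Kh_le_line hd' hL hLM hx hθ hlr0 hlr hDS0 hDS hc hε
  have hS := Sy_le_line hd hL hLM hx hθ hlr0 hlr hS20 hS2 hΛ hc hε
  have h2 := sTwo_le_line hd hL hLM hx hθ hlr0 hlr hS20 hS2 hΛ haU0 haU hc hε
  have hcx0 : 0 ≤ ((d : ℝ) - 1) * (M - 1) * x := mul_nonneg (mul_nonneg hdm (by linarith)) hx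
  have hcxM0 : 0 ≤ ((d : ℝ) - 1) * (M - 1) * M * x := mul_nonneg (mul_nonneg (mul_nonneg hdm (by linarith)) hM0.le) hx
  have hΛ0 : 0 ≤ Λ := by rw [hΛ]; positivity
  have hSY0 : 0 ≤ syExpr d c M x lr S2 Λ ε := by unfold syExpr; positivity
  have hKH1 : 0 ≤ khExpr d L c M x lr DS ε := by unfold khExpr g8Expr bhExpr; positivity
  have hKL0 : 0 ≤ KhLine d L c ε θ := hKH1.trans hK
  have h1 : 2 * khExpr d L c M x lr DS ε * syExpr d c M x lr S2 Λ ε ≤ 2 * KhLine d L c ε θ * SyLine d L c ε θ :=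
    mul_le_mul (mul_le_mul_of_nonneg_left hK (by norm_num)) hS hSY0 (mul_nonneg (by norm_num) hKL0)
  unfold SmallYLine
  exact add_le_add h1 h2

end

end Summit.QuantumFields.BalabanUV.T4Continuum.NE3SlicePoincareBudgetLineY
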